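import Literature.NumberTheory.Sieve.RomanovConstantPintzObservation
import Literature.NumberTheory.Sieve.Pintz2006Lemma4
import HarnessLib

/-!
# Romanov's constant by Pintz's method: from the first two moments of `r(n)` to a lower density, typed
(Cauchy–Schwarz and Pintz's Lemma 4′; the numerical certificates used for the printed values)

Topic `Literature/NumberTheory/Sieve`.  Sequel to `RomanovConstantPintzObservation.lean` (Pintz's `d > 1/4 ⇒ K = 2`) and
`Pintz2006Lemma4.lean` (the integer refinement of Cauchy–Schwarz).  **THIS IS NOT A ROUTE TO GOLDBACH and proves no
analytic estimate.**  Every printed lower bound for Romanov's constant `d = liminf N⁻¹#{n ≤ N : n = p + 2^k}` (Chen–Sun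
2004, Habsieger–Roblot 2006, Pintz 2006, Habsieger–Sivak-Fischler 2010, Johnston–Trudgian 2026; the exception is the
residue-class method of Elsholtz–Schlage-Puchta 2018) is obtained by ONE deduction from two analytic inputs, which enter
here as explicit HYPOTHESES on an arbitrary function `r : ℕ → ℕ` whose support is Romanov's set (`hr`; e.g. Pintz's /
Johnston–Trudgian's `r(n) = #{(p, a) : n = p + 2^a}`, Habsieger–Roblot's `#{(p, k) : n = p + 2^k, p ≤ N, k ≤ L}`):

* first moment `S₁(N) = Σ_{n ≤ N} r(n) ≥ (1/log 2 − ε)N` (prime number theorem: `S₁ ∼ π(N) log₂ N`; Pintz 2006 Prop. 2,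
  Johnston–Trudgian v2 §4.1 "`S₁(N) ∼ N/log 2`");
* second moment `S₂(N) = Σ_{n ≤ N} r(n)² ≤ (D/log 2 + ε)N`, i.e. `S₂ ≤ C̃N` with `D = C̃ log 2 = 1 + C₀C₁R₀/log 2`
  (upper-bound sieve for prime pairs + Romanov's series; Pintz 2006 Lemma 3′ `C̃ = (1/log 2)(C₀(C₁+ε)R₀/log 2 + 1)`,
  Pintz–Ruzsa I Lemma 10, Chen–Sun (4)–(5));

and the deduction is either Cauchy–Schwarz, `d ≥ 1/(D log 2)` (Romanov; Chen–Sun; Habsieger–Roblot's first bound), or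
Pintz's Lemma 4′ with a parameter `k ≥ 1` (optimal `k = ⌊D⌋`), `d ≥ (2k + 1 − D)/(k(k + 1) log 2)` (Johnston–Trudgian v2
§4.1 verbatim: "setting `M = N/log 2` and `D = C̃ log 2` in Lemma 4′").  Proved here:

* §1 the finite inequalities `(2k+1)S₁ − S₂ ≤ k(k+1)·#support` (`moments_le_card_support`, summing the tree's
  `Pintz2006.pointwise`) and `S₁² ≤ #support · S₂` (`sq_sum_le_card_support_mul`);
* §2 their asymptotic forms for general `(M, C)` (`eventually_card_support_ge`, `eventually_card_support_ge_cs`) and the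
  Romanov specialisations (`eventually_card_romanovSet_ge`: value `(2k+1−D)/(k(k+1) log 2)`; `…_cs`: value
  `1/(D log 2)`), and the combination with Pintz's observation (`goldbach_linnik_two_of_moments`: if the value exceeds
  `1/4` then `goldbach_linnik_with 2` — Pintz's "`K = 2` would follow from `C₁′ ≤ 2.603226`");
* §3 generic numerical certificates (`pintzD_le_of`, `pintzD_ge_of`, `pintzValue_ge_of`, `pintzValue_lt_of`,
  `csValue_ge_of`) turning decimal bounds on `X = C₀C₁R₀` into bounds on the values, with `Real.log 2` through Mathlib's
  `Real.log_two_gt_d9` / `Real.log_two_lt_d9`; the printed numbers themselves are in `RomanovConstantLowerBounds.lean`.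

No definitions, no named facts.

## References

* J. Pintz, *A note on Romanov's constant*, Acta Math. Hungar. 112 (2006) 1–14: Prop. 2, Lemma 3′, Lemma 4′ (not held;
  quoted through Johnston–Trudgian v2 §4.1). [Pintz2006]
* D. R. Johnston, T. Trudgian, *An update on the Linnik–Goldbach problem*, arXiv:2605.17825v2 (2026), §4.1 (Pintz's
  method: `r(n)`, `S₁ ∼ N/log 2`, `S₂ ≤ C̃N`, `d > 1/C̃ log² 2`, Lemma (pintzdenlem), `M = N/log 2`, `D = C̃ log 2`).
  [JohnstonTrudgian2026]
* Y.-G. Chen, X.-G. Sun, *On Romanoff's constant*, J. Number Theory 106 (2004) 275–284, proof of Thm 1 ((5): "By Lemma 1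
  and the Cauchy inequality"). [ChenSun2004]
* L. Habsieger, X.-F. Roblot, *On integers of the form p + 2^k*, Acta Arith. 122 (2006) 45–50, §2 (`(π(N)L)² ≤ d(N)s(N)`,
  `r(n)`, `s(N) = Σ r(n)²`). [HabsiegerRoblot2006]
* J. Pintz, I. Z. Ruzsa, *On Linnik's approximation to Goldbach's problem, I*, Acta Arith. 109 (2003), Lemma 10.
  [PintzRuzsa2003]
-/

noncomputable section

open Finset Filter

namespace Literature.NumberTheory.Sieve

namespace RomanovConstant

open Romanov

/-! ### §1 The two finite deductions -/

/-- The support of any representation function `r` with `r(n) > 0 ↔ n = p + 2^k (p prime, k ≥ 1)` in `[0, N]` is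
Romanov's set. [folklore] -/
theorem filter_pos_eq_romanovSet {r : ℕ → ℕ} (hr : ∀ n, 0 < r n ↔ ∃ p k : ℕ, p.Prime ∧ 1 ≤ k ∧ p + 2 ^ k = n)
    (N : ℕ) : (Finset.range (N + 1)).filter (fun n => 0 < r n) = romanovSet N := by
  ext n
  rw [Finset.mem_filter, Finset.mem_range, Nat.lt_succ_iff, mem_romanovSet, hr]

/-- **Lemma 4′ summed** (the deduction step of Pintz's method, any parameter `k`): for `r : ι → ℕ` on a finite
set `s`, `(2k + 1) Σ r − Σ r² ≤ k(k + 1) · #{i ∈ s : r i > 0}`.  Summing the tree's pointwise inequality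
`Pintz2006.pointwise`; for `k = ⌊D⌋`, `Σ r² ≤ D Σ r` this is `Pintz2006.lemma4'`.
[cite: Pintz2006, Lemma 4′] [cite: JohnstonTrudgian2026, v2 Lemma (pintzdenlem)] -/
theorem moments_le_card_support {ι : Type*} (s : Finset ι) (r : ι → ℕ) (k : ℕ) :
    (2 * k + 1 : ℝ) * (∑ i ∈ s, (r i : ℝ)) - ∑ i ∈ s, (r i : ℝ) ^ 2
      ≤ (k * (k + 1) : ℝ) * ((s.filter (fun i => 0 < r i)).card : ℝ) := by
  have hpt : ∀ i ∈ s,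
      (2 * k + 1 : ℝ) * r i ≤ (r i : ℝ) ^ 2 + (k * (k + 1) : ℝ) * (if 0 < r i then 1 else 0) :=
    fun i _ => Pintz2006.pointwise (r i) k
  have hsum := Finset.sum_le_sum hpt
  rw [Finset.sum_add_distrib, ← Finset.mul_sum, ← Finset.mul_sum, Finset.sum_boole] at hsum
  linarith

/-- **Cauchy–Schwarz form** (Romanov's original deduction; Chen–Sun (5), Habsieger–Roblot `(π(N)L)² ≤ d(N)s(N)`):
`(Σ r)² ≤ #{i ∈ s : r i > 0} · Σ r²`. [cite: ChenSun2004, proof of Thm 1 ("By Lemma 1 and the Cauchy inequality")]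
[cite: HabsiegerRoblot2006, §2] -/
theorem sq_sum_le_card_support_mul {ι : Type*} (s : Finset ι) (r : ι → ℕ) :
    (∑ i ∈ s, (r i : ℝ)) ^ 2 ≤ ((s.filter (fun i => 0 < r i)).card : ℝ) * ∑ i ∈ s, (r i : ℝ) ^ 2 := by
  classical
  have h1 : ∑ i ∈ s, (r i : ℝ) = ∑ i ∈ s.filter (fun i => 0 < r i), (r i : ℝ) := by
    rw [Finset.sum_filter]
    refine Finset.sum_congr rfl (fun i _ => ?_)
    split_ifs with h
    · rfl
    · have : r i = 0 := by omega
      simp [this]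
  have h2 : ∑ i ∈ s.filter (fun i => 0 < r i), (r i : ℝ) ^ 2 ≤ ∑ i ∈ s, (r i : ℝ) ^ 2 :=
    Finset.sum_le_sum_of_subset_of_nonneg (Finset.filter_subset _ _) (fun i _ _ => by positivity)
  have h3 := sq_sum_le_card_mul_sum_sq (s := s.filter (fun i => 0 < r i)) (f := fun i => (r i : ℝ))
  rw [h1]
  exact h3.trans (mul_le_mul_of_nonneg_left h2 (Nat.cast_nonneg _))

/-! ### §2 Asymptotic forms and the Romanov specialisations -/

/-- **The method of Pintz, asymptotic form (parameter `k ≥ 1`).** If `S₁(N) = Σ_{n ≤ N} r(n) ≥ (M − ε)N` and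
`S₂(N) = Σ_{n ≤ N} r(n)² ≤ (C + ε)N` for every `ε > 0` and all large `N`, then
`#{n ≤ N : r(n) > 0} ≥ (((2k + 1)M − C)/(k(k + 1)) − ε)N` for every `ε > 0` and all large `N`.
[cite: Pintz2006, Lemma 4′ (application)] [cite: JohnstonTrudgian2026, v2 §4.1] -/
theorem eventually_card_support_ge (r : ℕ → ℕ) {M C : ℝ} {k : ℕ} (hk : 1 ≤ k)
    (hS1 : ∀ ε : ℝ, 0 < ε → ∀ᶠ N : ℕ in atTop, (M - ε) * N ≤ ∑ n ∈ Finset.range (N + 1), (r n : ℝ))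
    (hS2 : ∀ ε : ℝ, 0 < ε → ∀ᶠ N : ℕ in atTop,
      ∑ n ∈ Finset.range (N + 1), (r n : ℝ) ^ 2 ≤ (C + ε) * N) :
    ∀ ε : ℝ, 0 < ε → ∀ᶠ N : ℕ in atTop,
      (((2 * k + 1) * M - C) / (k * (k + 1)) - ε) * N
        ≤ (((Finset.range (N + 1)).filter (fun n => 0 < r n)).card : ℝ) := by
  intro ε hε
  have hK : (0 : ℝ) < k * (k + 1) := by
    have : (1 : ℝ) ≤ k := by exact_mod_cast hk
    positivity
  set ε' : ℝ := ε * (k * (k + 1)) / (2 * k + 2) with hε'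
  have hε'pos : 0 < ε' := by rw [hε']; positivity
  filter_upwards [hS1 ε' hε'pos, hS2 ε' hε'pos] with N h1 h2
  have hN : (0 : ℝ) ≤ N := Nat.cast_nonneg N
  have hmom := moments_le_card_support (Finset.range (N + 1)) r k
  set S1 := ∑ n ∈ Finset.range (N + 1), (r n : ℝ)
  set S2 := ∑ n ∈ Finset.range (N + 1), (r n : ℝ) ^ 2
  set A := (((Finset.range (N + 1)).filter (fun n => 0 < r n)).card : ℝ)
  -- (2k+1) S1 - S2 ≥ ((2k+1)(M - ε') - (C + ε')) N = ((2k+1)M - C) N - ε (k(k+1)) N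
  have hk1 : (0 : ℝ) ≤ 2 * k + 1 := by positivity
  have h3 : (2 * k + 1 : ℝ) * ((M - ε') * N) ≤ (2 * k + 1 : ℝ) * S1 := mul_le_mul_of_nonneg_left h1 hk1
  have hkey : (((2 * k + 1) * M - C) - ε * (k * (k + 1))) * N ≤ (k * (k + 1) : ℝ) * A := by
    have : ((2 * k + 1 : ℝ) * (M - ε') - (C + ε')) = ((2 * k + 1) * M - C) - ε * (k * (k + 1)) := by
      rw [hε']
      field_simp
      ring
    nlinarith
  rw [sub_mul, div_mul_eq_mul_div, div_sub' (hc := hK.ne'), div_le_iff₀ hK]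
  nlinarith

/-- **Cauchy–Schwarz, asymptotic form.** Under the same hypotheses with `M ≥ 0`, `C > 0`:
`#{n ≤ N : r(n) > 0} ≥ (M²/C − ε)N` eventually. [cite: ChenSun2004, proof of Thm 1] [cite: HabsiegerRoblot2006, §2] -/
theorem eventually_card_support_ge_cs (r : ℕ → ℕ) {M C : ℝ} (hM : 0 ≤ M) (hC : 0 < C)
    (hS1 : ∀ ε : ℝ, 0 < ε → ∀ᶠ N : ℕ in atTop, (M - ε) * N ≤ ∑ n ∈ Finset.range (N + 1), (r n : ℝ))
    (hS2 : ∀ ε : ℝ, 0 < ε → ∀ᶠ N : ℕ in atTop,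
      ∑ n ∈ Finset.range (N + 1), (r n : ℝ) ^ 2 ≤ (C + ε) * N) :
    ∀ ε : ℝ, 0 < ε → ∀ᶠ N : ℕ in atTop,
      (M ^ 2 / C - ε) * N ≤ (((Finset.range (N + 1)).filter (fun n => 0 < r n)).card : ℝ) := by
  intro ε hε
  -- choose ε' with (M - ε')² / (C + ε') ≥ M²/C - ε : the map is continuous at 0; we use an explicit bound.
  -- (M-ε')² ≥ M² - 2Mε' and 1/(C+ε') ≥ (1 - ε'/C)/C, so (M-ε')²/(C+ε') ≥ M²/C - ε'(2M/C + M²/C²).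
  set L : ℝ := 2 * M / C + M ^ 2 / C ^ 2 + 1 with hL
  have hLpos : 0 < L := by rw [hL]; positivity
  set ε' : ℝ := min (ε / L) M with hε'def
  rcases eq_or_lt_of_le hM with hM0 | hMpos
  · -- M = 0: the claim is `-ε N ≤ #`, trivial
    filter_upwards with N
    have hN : (0 : ℝ) ≤ N := Nat.cast_nonneg N
    have h0 : M ^ 2 / C - ε ≤ 0 := by
      rw [← hM0]
      have : (0 : ℝ) ^ 2 / C = 0 := by simp
      linarith
    exact (mul_nonpos_iff.mpr (Or.inr ⟨h0, hN⟩)).trans (Nat.cast_nonneg _)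
  have hε'pos : 0 < ε' := lt_min (by positivity) hMpos
  have hε'M : ε' ≤ M := min_le_right _ _
  have hε'L : ε' * L ≤ ε := by
    have : ε' ≤ ε / L := min_le_left _ _
    rwa [le_div_iff₀ hLpos] at this
  filter_upwards [hS1 ε' hε'pos, hS2 ε' hε'pos] with N h1 h2
  have hN : (0 : ℝ) ≤ N := Nat.cast_nonneg N
  set S1 := ∑ n ∈ Finset.range (N + 1), (r n : ℝ)
  set S2 := ∑ n ∈ Finset.range (N + 1), (r n : ℝ) ^ 2
  set A := (((Finset.range (N + 1)).filter (fun n => 0 < r n)).card : ℝ)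
  have hcs : S1 ^ 2 ≤ A * S2 := sq_sum_le_card_support_mul (Finset.range (N + 1)) r
  have hA0 : 0 ≤ A := Nat.cast_nonneg _
  have hS1nn : 0 ≤ (M - ε') * N := mul_nonneg (by linarith) hN
  have h4 : ((M - ε') * N) ^ 2 ≤ A * ((C + ε') * N) := by
    calc ((M - ε') * N) ^ 2 ≤ S1 ^ 2 := pow_le_pow_left₀ hS1nn h1 2
      _ ≤ A * S2 := hcs
      _ ≤ A * ((C + ε') * N) := mul_le_mul_of_nonneg_left h2 hA0
  -- divide by (C + ε') N (if N = 0 trivial)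
  rcases eq_or_lt_of_le hN with hN0 | hNpos
  · rw [← hN0, mul_zero]; exact hA0
  have hCe : 0 < C + ε' := by linarith
  have h5 : (M - ε') ^ 2 / (C + ε') * N ≤ A := by
    rw [div_mul_eq_mul_div, div_le_iff₀ hCe]
    nlinarith
  -- (M - ε')²/(C + ε') ≥ M²/C - ε
  have h6 : M ^ 2 / C - ε ≤ (M - ε') ^ 2 / (C + ε') := by
    rw [le_div_iff₀ hCe]
    have hC2 : 0 < C ^ 2 := by positivity
    -- M²/C·(C+ε') = M² + M² ε'/C ;  need M² + M²ε'/C - ε(C+ε') ≤ M² - 2Mε' + ε'²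
    have e1 : M ^ 2 / C * (C + ε') = M ^ 2 + M ^ 2 / C * ε' := by field_simp
    have e2 : ε' * (2 * M / C + M ^ 2 / C ^ 2 + 1) ≤ ε := by rw [← hL]; exact hε'L
    have e3 : M ^ 2 / C ^ 2 * ε' * C = M ^ 2 / C * ε' := by field_simp
    have e4 : 2 * M / C * ε' * C = 2 * M * ε' := by field_simp
    nlinarith [mul_le_mul_of_nonneg_right e2 hCe.le, sq_nonneg ε', mul_pos hC hε'pos,
      mul_nonneg (mul_nonneg hMpos.le hε'pos.le) hε'pos.le]
  calc (M ^ 2 / C - ε) * N ≤ (M - ε') ^ 2 / (C + ε') * N := mul_le_mul_of_nonneg_right h6 hN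
    _ ≤ A := h5

/-- **Romanov's constant by Pintz's method, typed.** For any `r : ℕ → ℕ` supported on Romanov's set (`hr`), if
`S₁(N) = Σ_{n ≤ N} r(n) ≥ (1/log 2 − ε)N` (prime number theorem; Pintz Prop. 2) and `S₂(N) ≤ (D/log 2 + ε)N` (sieve;
Pintz Lemma 3′ with `D = C̃ log 2 = 1 + C₀C₁R₀/log 2`) for every `ε > 0`, eventually, then for every `k ≥ 1` and `ε > 0`,
eventually `#romanovSet N ≥ ((2k + 1 − D)/(k(k + 1) log 2) − ε)N` — Johnston–Trudgian's
`(⌈D⌉ + ⌊D⌋ − D)/(⌈D⌉⌊D⌋) · N/log 2` for `k = ⌊D⌋`, `D ∉ ℤ`.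
[cite: Pintz2006, Prop. 2, Lemma 3′, Lemma 4′] [cite: JohnstonTrudgian2026, v2 §4.1 ("setting M = N/log 2 and D = C̃ log 2 in Lemma 4′")] -/
theorem eventually_card_romanovSet_ge {r : ℕ → ℕ}
    (hr : ∀ n, 0 < r n ↔ ∃ p k : ℕ, p.Prime ∧ 1 ≤ k ∧ p + 2 ^ k = n) {D : ℝ} {k : ℕ} (hk : 1 ≤ k)
    (hS1 : ∀ ε : ℝ, 0 < ε → ∀ᶠ N : ℕ in atTop,
      (1 / Real.log 2 - ε) * N ≤ ∑ n ∈ Finset.range (N + 1), (r n : ℝ))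
    (hS2 : ∀ ε : ℝ, 0 < ε → ∀ᶠ N : ℕ in atTop,
      ∑ n ∈ Finset.range (N + 1), (r n : ℝ) ^ 2 ≤ (D / Real.log 2 + ε) * N) :
    ∀ ε : ℝ, 0 < ε → ∀ᶠ N : ℕ in atTop,
      (((2 * k + 1) - D) / (k * (k + 1) * Real.log 2) - ε) * N ≤ ((romanovSet N).card : ℝ) := by
  intro ε hε
  have h := eventually_card_support_ge r hk hS1 hS2 ε hε
  have hl : Real.log 2 ≠ 0 := (Real.log_pos one_lt_two).ne'
  have hK : (k : ℝ) * (k + 1) ≠ 0 := by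
    have : (1 : ℝ) ≤ k := by exact_mod_cast hk
    positivity
  have hval : ((2 * k + 1) * (1 / Real.log 2) - D / Real.log 2) / (k * (k + 1)) =
      ((2 * k + 1) - D) / (k * (k + 1) * Real.log 2) := by
    field_simp
  filter_upwards [h] with N hN
  rwa [hval, filter_pos_eq_romanovSet hr] at hN

/-- **Cauchy–Schwarz version** (Romanov / Chen–Sun / Habsieger–Roblot): same hypotheses, `D > 0`; eventually
`#romanovSet N ≥ (1/(D log 2) − ε)N` (Chen–Sun: `𝓐(x) ≥ (x/log 2 + o(x))²/Σr²`; Habsieger–Roblot: "`d ≥ 1/C`" with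
`D log 2 = 2C`). [cite: ChenSun2004, proof of Thm 1] [cite: HabsiegerRoblot2006, §2] -/
theorem eventually_card_romanovSet_ge_cs {r : ℕ → ℕ}
    (hr : ∀ n, 0 < r n ↔ ∃ p k : ℕ, p.Prime ∧ 1 ≤ k ∧ p + 2 ^ k = n) {D : ℝ} (hD : 0 < D)
    (hS1 : ∀ ε : ℝ, 0 < ε → ∀ᶠ N : ℕ in atTop,
      (1 / Real.log 2 - ε) * N ≤ ∑ n ∈ Finset.range (N + 1), (r n : ℝ))
    (hS2 : ∀ ε : ℝ, 0 < ε → ∀ᶠ N : ℕ in atTop,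
      ∑ n ∈ Finset.range (N + 1), (r n : ℝ) ^ 2 ≤ (D / Real.log 2 + ε) * N) :
    ∀ ε : ℝ, 0 < ε → ∀ᶠ N : ℕ in atTop, (1 / (D * Real.log 2) - ε) * N ≤ ((romanovSet N).card : ℝ) := by
  intro ε hε
  have hl : 0 < Real.log 2 := Real.log_pos one_lt_two
  have h := eventually_card_support_ge_cs r (M := 1 / Real.log 2) (C := D / Real.log 2)
    (by positivity) (by positivity) hS1 hS2 ε hε
  have hval : (1 / Real.log 2) ^ 2 / (D / Real.log 2) = 1 / (D * Real.log 2) := by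
    field_simp
  filter_upwards [h] with N hN
  rwa [hval, filter_pos_eq_romanovSet hr] at hN

/-- **Pintz's "`K = 2`" criterion, typed**: if the moment hypotheses hold with some `D` and the value
`(2k + 1 − D)/(k(k + 1) log 2)` exceeds `1/4` for some `k ≥ 1`, then `goldbach_linnik_with 2`
(`goldbach_linnik_two_of_density_gt_quarter` + `eventually_card_romanovSet_ge`).  Pintz: this happens for a pair-sieve
constant `C₁′ ≤ 2.603226` (`RomanovConstantLowerBounds.pintz_Ktwo_threshold_asPrinted`).
[cite: Pintz2006, §1] [cite: JohnstonTrudgian2026, v1 §4.2 (Proposition Pintzobs, "C₁′ ≤ 2.603226")] -/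
theorem goldbach_linnik_two_of_moments {r : ℕ → ℕ}
    (hr : ∀ n, 0 < r n ↔ ∃ p k : ℕ, p.Prime ∧ 1 ≤ k ∧ p + 2 ^ k = n) {D : ℝ} {k : ℕ} (hk : 1 ≤ k)
    (hval : 1 / 4 < ((2 * k + 1) - D) / (k * (k + 1) * Real.log 2))
    (hS1 : ∀ ε : ℝ, 0 < ε → ∀ᶠ N : ℕ in atTop,
      (1 / Real.log 2 - ε) * N ≤ ∑ n ∈ Finset.range (N + 1), (r n : ℝ))
    (hS2 : ∀ ε : ℝ, 0 < ε → ∀ᶠ N : ℕ in atTop,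
      ∑ n ∈ Finset.range (N + 1), (r n : ℝ) ^ 2 ≤ (D / Real.log 2 + ε) * N) :
    goldbach_linnik_with 2 := by
  set v : ℝ := ((2 * k + 1) - D) / (k * (k + 1) * Real.log 2) with hv
  refine goldbach_linnik_two_of_density_gt_quarter (δ := (v + 1 / 4) / 2) (by linarith) ?_
  have h := eventually_card_romanovSet_ge hr hk hS1 hS2 ((v - 1 / 4) / 2) (by linarith)
  filter_upwards [h] with N hN
  have : (v + 1 / 4) / 2 = v - (v - 1 / 4) / 2 := by ring
  rwa [this]

/-! ### §3 Generic numerical certificates (`D = 1 + X/log 2`, `X = C₀C₁R₀`; `0.6931471803 < log 2 < 0.6931471808`) -/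

/-- `1 + X/log 2 ≤ 1 + a/0.6931471803` for `0 ≤ X ≤ a`. [folklore] -/
theorem pintzD_le_of {X a : ℝ} (hX : 0 ≤ X) (hXa : X ≤ a) : 1 + X / Real.log 2 ≤ 1 + a / 0.6931471803 := by
  have hl : (0.6931471803 : ℝ) < Real.log 2 := Real.log_two_gt_d9
  have h1 : X / Real.log 2 ≤ X / 0.6931471803 := div_le_div_of_nonneg_left hX (by norm_num) hl.le
  have h2 : X / (0.6931471803 : ℝ) ≤ a / 0.6931471803 := div_le_div_of_nonneg_right hXa (by norm_num)
  linarith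

/-- `1 + X/log 2 ≥ 1 + a/0.6931471808` for `0 ≤ a ≤ X`. [folklore] -/
theorem pintzD_ge_of {X a : ℝ} (ha : 0 ≤ a) (haX : a ≤ X) : 1 + a / 0.6931471808 ≤ 1 + X / Real.log 2 := by
  have hl : Real.log 2 < 0.6931471808 := Real.log_two_lt_d9
  have hl0 : 0 < Real.log 2 := Real.log_pos one_lt_two
  have h1 : a / (0.6931471808 : ℝ) ≤ a / Real.log 2 := div_le_div_of_nonneg_left ha hl0 hl.le
  have h2 : a / Real.log 2 ≤ X / Real.log 2 := div_le_div_of_nonneg_right haX hl0.le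
  linarith

/-- Lower certificate for Pintz's value (real parameter `κ ≥ 1`): `v ≤ (2κ + 1 − D)/(κ(κ + 1) log 2)` whenever
`D ≤ Dmax`, `v ≥ 0` and `v · κ(κ+1) · 0.6931471808 ≤ 2κ + 1 − Dmax`. [folklore] -/
theorem pintzValue_ge_of {κ D Dmax v : ℝ} (hκ : 1 ≤ κ) (hD : D ≤ Dmax) (hv : 0 ≤ v)
    (h : v * (κ * (κ + 1)) * 0.6931471808 ≤ (2 * κ + 1) - Dmax) :
    v ≤ ((2 * κ + 1) - D) / (κ * (κ + 1) * Real.log 2) := by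
  have hl : Real.log 2 < 0.6931471808 := Real.log_two_lt_d9
  have hl0 : 0 < Real.log 2 := Real.log_pos one_lt_two
  have hK : (0 : ℝ) < κ * (κ + 1) := by nlinarith
  rw [le_div_iff₀ (by positivity)]
  have : v * (κ * (κ + 1) * Real.log 2) ≤ v * (κ * (κ + 1)) * 0.6931471808 := by
    have := mul_le_mul_of_nonneg_left hl.le (mul_nonneg hv hK.le)
    nlinarith
  linarith

/-- Upper certificate: `(2κ + 1 − D)/(κ(κ + 1) log 2) < v` whenever `Dmin ≤ D`, `0 ≤ v` and
`2κ + 1 − Dmin < v · κ(κ+1) · 0.6931471803`. [folklore] -/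
theorem pintzValue_lt_of {κ D Dmin v : ℝ} (hκ : 1 ≤ κ) (hD : Dmin ≤ D) (hv : 0 ≤ v)
    (h : (2 * κ + 1) - Dmin < v * (κ * (κ + 1)) * 0.6931471803) :
    ((2 * κ + 1) - D) / (κ * (κ + 1) * Real.log 2) < v := by
  have hl : (0.6931471803 : ℝ) < Real.log 2 := Real.log_two_gt_d9
  have hK : (0 : ℝ) < κ * (κ + 1) := by nlinarith
  rw [div_lt_iff₀ (by positivity)]
  have : v * (κ * (κ + 1)) * 0.6931471803 ≤ v * (κ * (κ + 1) * Real.log 2) := by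
    have := mul_le_mul_of_nonneg_left hl.le (mul_nonneg hv hK.le)
    nlinarith
  linarith

/-- Lower certificate for the Cauchy–Schwarz value: `v ≤ 1/(D log 2)` whenever `0 < D ≤ Dmax`, `0 ≤ v` and
`v · Dmax · 0.6931471808 ≤ 1`. [folklore] -/
theorem csValue_ge_of {D Dmax v : ℝ} (hD0 : 0 < D) (hD : D ≤ Dmax) (hv : 0 ≤ v)
    (h : v * Dmax * 0.6931471808 ≤ 1) : v ≤ 1 / (D * Real.log 2) := by
  have hl : Real.log 2 < 0.6931471808 := Real.log_two_lt_d9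
  have hl0 : 0 < Real.log 2 := Real.log_pos one_lt_two
  rw [le_div_iff₀ (by positivity)]
  have h1 : v * (D * Real.log 2) ≤ v * (Dmax * 0.6931471808) := by
    have : D * Real.log 2 ≤ Dmax * 0.6931471808 := mul_le_mul hD hl.le hl0.le (by linarith)
    exact mul_le_mul_of_nonneg_left this hv
  linarith

end RomanovConstant

end Literature.NumberTheory.Sieve
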